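import Literature.MathematicalPhysics.QuantumFieldTheory.QCDPhaseQuenchedReweighting
import Literature.MathematicalPhysics.QuantumLattice.WilsonPropagatorHeavyMass
import HarnessLib

/-!
# Heavy-quark regime of lattice QCD with Wilson fermions: the `N_f`-flavour propagator and the
phase-quenched fractional moment

Topic `Literature/MathematicalPhysics/QuantumFieldTheory`; namespace
`Literature.MathematicalPhysics.QuantumFieldTheory`.

The tree's `N_f`-flavour Wilson matrix `diracMatrix U mq` (`QCDOS.lean`) is flavour-diagonal, so
its inverse is the flavour-diagonal matrix of one-flavour propagators as soon as every
`D_W(m_f)` is invertible (`inv_diracMatrix_apply_same_flavour`, `inv_diracMatrix_apply_of_ne`);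
with `WilsonPropagatorHeavyMass` this gives, for bare masses `m_f ≥ m₀ > 0`, on every torus and for
every `SU(3)` field: `det (diracMatrix U mq) ≠ 0` and
`|(diracMatrix U mq)⁻¹((f,p),(f,q))| ≤ m₀⁻¹ (4/(m₀+4))^{d_i(p,q)}`
(`norm_inv_diracMatrix_apply_le_of_le`).  Integrating against the Wilson measure reweighted by
`|det|` (a positive weight, never vanishing here) yields the **heavy-regime phase-quenched
fractional-moment bound** `phaseQuenched_fractionalMoment_decay_of_heavy`: along ANY bare data
`(a_k → 0, β_k, L_k, M_k)` with `M_k(f) ≥ m₀ > 0` eventually, the quantity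
`E_{|w|,k,S}[(Σ_{colour,spin}|G_f(0,v)|)^{1/2}]` is `≤ (144/m₀)^{1/2} e^{-a_k ‖v‖∞}` for all large
`k`, all `S`, all `v ∈ box S` — literally the UPPER clause (ii) of route `WilsonMobilityGap`'s
`MobilityGap` / the hypothesis of crux `PhaseQuenchedFlavourDecay` (stmt-QuantumFields-9150/9151),
which is therefore satisfiable non-vacuously at every `N_f` (heavy quarks: both it and the
conclusions are expected to hold there; the live regime of those items is the supercritical
window).  This is the convergence statement of the hopping-parameter expansion (Montvay–Münster
§5.1.2–5.1.3: for `κ < 1/8` the quark propagator expansion converges uniformly in the gauge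
field, giving exponential decay with the distance) in the tree's conventions.

Not here: the honest (signed) measure, `r ≠ 1`, optimal rates, anything supercritical.
-/

noncomputable section

open MeasureTheory Filter Topology
open Literature.MathematicalPhysics.QuantumLattice Literature.Probability.LatticeModels

namespace Literature.MathematicalPhysics.QuantumFieldTheory

variable {Nf S : ℕ} [NeZero S]

/-- **The inverse of the flavour-diagonal `diracMatrix` is flavour-diagonal with the one-flavour
propagators as blocks** — same-flavour entries (all `D_W(m_f)` invertible).
[cite: MontvayMunster1994, §5.1 (flavour-diagonal Wilson action)] -/
theorem inv_diracMatrix_apply_same_flavour (U : GaugeConfig 4 S SU3) (mq : Fin Nf → ℝ)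
    (h : ∀ f, (wilsonDirac (fundamentalRep (Fin 3)) U (mq f) 1).det ≠ 0) (f : Fin Nf)
    (p q : TorusSite 4 S × Fin 3 × Fin 4) :
    (diracMatrix U mq)⁻¹ (quarkEquiv (f, p)) (quarkEquiv (f, q)) =
      (wilsonDirac (fundamentalRep (Fin 3)) U (mq f) 1)⁻¹ p q := by
  set B : Matrix (QuarkVar Nf S) (QuarkVar Nf S) ℂ := Matrix.of fun v w =>
    if v.1 = w.1 then wilsonDirac (fundamentalRep (Fin 3)) U (mq v.1) 1 v.2 w.2 else 0 with hB
  set V : Matrix (QuarkVar Nf S) (QuarkVar Nf S) ℂ := Matrix.of fun v w =>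
    if v.1 = w.1 then (wilsonDirac (fundamentalRep (Fin 3)) U (mq v.1) 1)⁻¹ v.2 w.2 else 0 with hV
  have hunit : ∀ g, wilsonDirac (fundamentalRep (Fin 3)) U (mq g) 1 *
      (wilsonDirac (fundamentalRep (Fin 3)) U (mq g) 1)⁻¹ = 1 := fun g =>
    Matrix.mul_nonsing_inv _ ((isUnit_iff_ne_zero).2 (h g))
  have hBV : B * V = 1 := by
    ext ⟨f', p'⟩ ⟨g, q'⟩
    rw [Matrix.mul_apply, Fintype.sum_prod_type]
    simp only [hB, hV, Matrix.of_apply]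
    by_cases hfg : f' = g
    · subst hfg
      rw [Finset.sum_eq_single f']
      · simp only [if_true]
        rw [← Matrix.mul_apply, hunit, Matrix.one_apply, Matrix.one_apply]
        by_cases hpq : p' = q'
        · subst hpq; simp
        · rw [if_neg hpq, if_neg (fun h' => hpq (Prod.ext_iff.1 h').2)]
      · intro h' _ hne
        exact Finset.sum_eq_zero fun r _ => by rw [if_neg (Ne.symm hne), zero_mul]
      · intro hf; exact absurd (Finset.mem_univ f') hf
    · rw [Matrix.one_apply, if_neg (fun h' => hfg (Prod.ext_iff.1 h').1)]
      refine Finset.sum_eq_zero fun h' _ => Finset.sum_eq_zero fun r _ => ?_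
      by_cases h1 : f' = h'
      · subst h1; rw [if_neg hfg, mul_zero]
      · rw [if_neg h1, zero_mul]
  have hD : diracMatrix U mq = Matrix.reindex quarkEquiv quarkEquiv B := rfl
  rw [hD, Matrix.inv_reindex, Matrix.reindex_apply, Matrix.submatrix_apply, Equiv.symm_apply_apply,
    Equiv.symm_apply_apply, Matrix.inv_eq_right_inv hBV]
  simp [hV]

/-- The inverse of `diracMatrix` vanishes between different flavours (all `D_W(m_f)` invertible).
[cite: MontvayMunster1994, §5.1 (flavour-diagonal Wilson action)] -/
theorem inv_diracMatrix_apply_of_ne (U : GaugeConfig 4 S SU3) (mq : Fin Nf → ℝ)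
    (h : ∀ f, (wilsonDirac (fundamentalRep (Fin 3)) U (mq f) 1).det ≠ 0) {f g : Fin Nf}
    (hfg : f ≠ g) (p q : TorusSite 4 S × Fin 3 × Fin 4) :
    (diracMatrix U mq)⁻¹ (quarkEquiv (f, p)) (quarkEquiv (g, q)) = 0 := by
  set B : Matrix (QuarkVar Nf S) (QuarkVar Nf S) ℂ := Matrix.of fun v w =>
    if v.1 = w.1 then wilsonDirac (fundamentalRep (Fin 3)) U (mq v.1) 1 v.2 w.2 else 0 with hB
  set V : Matrix (QuarkVar Nf S) (QuarkVar Nf S) ℂ := Matrix.of fun v w =>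
    if v.1 = w.1 then (wilsonDirac (fundamentalRep (Fin 3)) U (mq v.1) 1)⁻¹ v.2 w.2 else 0 with hV
  have hunit : ∀ g, wilsonDirac (fundamentalRep (Fin 3)) U (mq g) 1 *
      (wilsonDirac (fundamentalRep (Fin 3)) U (mq g) 1)⁻¹ = 1 := fun g =>
    Matrix.mul_nonsing_inv _ ((isUnit_iff_ne_zero).2 (h g))
  have hBV : B * V = 1 := by
    ext ⟨f', p'⟩ ⟨g', q'⟩
    rw [Matrix.mul_apply, Fintype.sum_prod_type]
    simp only [hB, hV, Matrix.of_apply]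
    by_cases hfg' : f' = g'
    · subst hfg'
      rw [Finset.sum_eq_single f']
      · simp only [if_true]
        rw [← Matrix.mul_apply, hunit, Matrix.one_apply, Matrix.one_apply]
        by_cases hpq : p' = q'
        · subst hpq; simp
        · rw [if_neg hpq, if_neg (fun h' => hpq (Prod.ext_iff.1 h').2)]
      · intro h' _ hne
        exact Finset.sum_eq_zero fun r _ => by rw [if_neg (Ne.symm hne), zero_mul]
      · intro hf; exact absurd (Finset.mem_univ f') hf
    · rw [Matrix.one_apply, if_neg (fun h' => hfg' (Prod.ext_iff.1 h').1)]
      refine Finset.sum_eq_zero fun h' _ => Finset.sum_eq_zero fun r _ => ?_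
      by_cases h1 : f' = h'
      · subst h1; rw [if_neg hfg', mul_zero]
      · rw [if_neg h1, zero_mul]
  have hD : diracMatrix U mq = Matrix.reindex quarkEquiv quarkEquiv B := rfl
  rw [hD, Matrix.inv_reindex, Matrix.reindex_apply, Matrix.submatrix_apply, Equiv.symm_apply_apply,
    Equiv.symm_apply_apply, Matrix.inv_eq_right_inv hBV]
  simp [hV, hfg]

/-- `det (diracMatrix U mq) ≠ 0` when every one-flavour determinant is non-zero (block product).
[cite: MontvayMunster1994, §5.1 (flavour-diagonal Wilson action)] -/
theorem det_diracMatrix_ne_zero_of_forall (U : GaugeConfig 4 S SU3) (mq : Fin Nf → ℝ)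
    (h : ∀ f, (wilsonDirac (fundamentalRep (Fin 3)) U (mq f) 1).det ≠ 0) :
    (diracMatrix U mq).det ≠ 0 := by
  rw [det_diracMatrix]
  exact Finset.prod_ne_zero_iff.2 fun f _ => h f

/-- **For positive bare masses the `N_f`-flavour Wilson determinant never vanishes** (every torus,
every `SU(3)` field). [cite: MontvayMunster1994, §5.1.2 (hopping parameter expansion)] -/
theorem det_diracMatrix_ne_zero_of_pos (U : GaugeConfig 4 S SU3) (mq : Fin Nf → ℝ)
    (h : ∀ f, 0 < mq f) : (diracMatrix U mq).det ≠ 0 :=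
  det_diracMatrix_ne_zero_of_forall U mq fun f =>
    wilsonDirac_det_ne_zero_of_pos (fundamentalRep (Fin 3)) fundamentalRep_mem_unitaryGroup U (h f)

/-- **Heavy-quark propagator bound**: for bare masses `≥ m₀ > 0`, every same-flavour entry of
`(diracMatrix U mq)⁻¹` between sites `p.1, q.1` is `≤ m₀⁻¹ (4/(m₀+4))^{d_i(p,q)}` for each coordinate
`i` (`d_i` the cyclic distance of the `i`-th coordinates), uniformly in the torus and the field.
[cite: MontvayMunster1994, §5.1.2 (hopping parameter expansion)] -/
theorem norm_inv_diracMatrix_apply_le_of_le (U : GaugeConfig 4 S SU3) (mq : Fin Nf → ℝ)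
    {m₀ : ℝ} (hm₀ : 0 < m₀) (hM : ∀ f, m₀ ≤ mq f) (f : Fin Nf)
    (p q : TorusSite 4 S × Fin 3 × Fin 4) (i : Fin 4) :
    ‖(diracMatrix U mq)⁻¹ (quarkEquiv (f, p)) (quarkEquiv (f, q))‖ ≤
      m₀⁻¹ * (4 / (m₀ + 4)) ^ (p.1 i - q.1 i).valMinAbs.natAbs := by
  have hpos : ∀ g, 0 < mq g := fun g => hm₀.trans_le (hM g)
  have hA : ∀ g, (wilsonDirac (fundamentalRep (Fin 3)) U (mq g) 1).det ≠ 0 := fun g =>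
    wilsonDirac_det_ne_zero_of_pos (fundamentalRep (Fin 3)) fundamentalRep_mem_unitaryGroup U (hpos g)
  rw [inv_diracMatrix_apply_same_flavour U mq hA]
  obtain ⟨-, hb⟩ := norm_inv_wilsonDirac_apply_le (fundamentalRep (Fin 3))
    fundamentalRep_mem_unitaryGroup U (hpos f) p q i
  refine hb.trans ?_
  rw [heavy_prefactor_eq (hpos f)]
  have hθ : 4 / (mq f + 4) ≤ 4 / (m₀ + 4) :=
    div_le_div_of_nonneg_left (by norm_num) (by linarith) (by linarith [hM f])
  have hθ0 : 0 ≤ 4 / (mq f + 4) := by have := hpos f; positivity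
  exact mul_le_mul (inv_anti₀ hm₀ (hM f)) (pow_le_pow_left₀ hθ0 hθ _) (pow_nonneg hθ0 _)
    (inv_nonneg.2 hm₀.le)

/-- **Heavy-regime phase-quenched fractional-moment bound** — the UPPER clause (ii) of
`MobilityGap` (route `WilsonMobilityGap`; = the hypothesis of crux `PhaseQuenchedFlavourDecay`)
along ANY bare data `(a_k, β_k, L_k, M_k)` with `a_k → 0` and `M_k(f) ≥ m₀ > 0` eventually: with
`s = ½`, `δ = 1`, `C = (144/m₀)^{1/2}`, for all large `k`, all `S ≥ L_k`, all flavours and all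
`v ∈ box S`, the `|det|`-reweighted Wilson average of `(Σ_{a,i,b,j} |G_f((0,a,i),(v,b,j))|)^{1/2}`
on the torus of side `2S+1` is `≤ C e^{-a_k ‖v‖}` (configuration-wise decay at lattice rate
`½ log((m₀+4)/4) ≥ a_k`, integrated against the positive weight; the denominator is positive since
`det ≠ 0` everywhere).  Hopping-parameter-expansion regime, written in the exact shape of the
route clause. [cite: MontvayMunster1994, §5.1.2 (hopping parameter expansion)] -/
theorem phaseQuenched_fractionalMoment_decay_of_heavy {Nf : ℕ} (a β : ℕ → ℝ) (L : ℕ → ℕ)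
    (M : ℕ → Fin Nf → ℝ) (ha0 : Tendsto a atTop (𝓝 0)) {m₀ : ℝ} (hm₀ : 0 < m₀)
    (hM : ∀ᶠ k in atTop, ∀ f, m₀ ≤ M k f) :
    ∃ s δ C : ℝ, 0 < s ∧ s < 1 ∧ 0 < δ ∧ ∀ᶠ k in atTop, ∀ S : ℕ, L k ≤ S →
      ∀ (f : Fin Nf) (v : _root_.Literature.Probability.LatticeModels.Site 4), v ∈ box 4 S →
        (∫ U : GaugeConfig 4 (2 * S + 1) SU3, ‖(diracMatrix U (M k)).det‖ *
            (∑ a : Fin 3, ∑ i : Fin 4, ∑ b : Fin 3, ∑ j : Fin 4,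
              ‖(diracMatrix U (M k))⁻¹ (quarkEquiv (f, (Torus.proj (2 * S + 1) 0, a, i)))
                (quarkEquiv (f, (Torus.proj (2 * S + 1) v, b, j)))‖) ^ s
            ∂(wilsonMeasure (fundamentalRep (Fin 3)) (β k))) /
          (∫ U : GaugeConfig 4 (2 * S + 1) SU3, ‖(diracMatrix U (M k)).det‖
            ∂(wilsonMeasure (fundamentalRep (Fin 3)) (β k))) ≤
          C * Real.exp (-(δ * (a k * ‖v‖))) := by
  set θ₀ : ℝ := 4 / (m₀ + 4) with hθ₀
  have hθ₀pos : 0 < θ₀ := by positivity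
  have hθ₀lt : θ₀ < 1 := by rw [hθ₀, div_lt_one (by linarith)]; linarith
  set ℓ : ℝ := -Real.log θ₀ with hℓ
  have hℓpos : 0 < ℓ := by rw [hℓ, neg_pos]; exact Real.log_neg hθ₀pos hθ₀lt
  set Cst : ℝ := (144 * m₀⁻¹) ^ (1 / 2 : ℝ) with hCst
  refine ⟨1 / 2, 1, Cst, by norm_num, by norm_num, one_pos, ?_⟩
  have hak : ∀ᶠ k in atTop, a k < ℓ / 2 := ha0.eventually (gt_mem_nhds (by positivity))
  filter_upwards [hM, hak] with k hMk hak S _hS f v hv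
  obtain ⟨i₀, -, hmax⟩ :=
    Finset.exists_max_image Finset.univ (fun i : Fin 4 => ‖v i‖) Finset.univ_nonempty
  have hvi : |v i₀| ≤ (S : ℤ) := by
    have := Fintype.mem_piFinset.1 hv i₀
    rw [Finset.mem_Icc] at this
    exact abs_le.2 ⟨by linarith [this.1], this.2⟩
  set n : ℕ := (v i₀).natAbs with hn
  have hnorm : ‖v‖ ≤ (n : ℝ) := by
    have h1 : ‖v‖ ≤ ‖v i₀‖ :=
      (pi_norm_le_iff_of_nonneg (norm_nonneg _)).2 fun i => hmax i (Finset.mem_univ i)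
    rw [Int.norm_eq_abs] at h1
    rw [hn, Nat.cast_natAbs, Int.cast_abs]
    exact h1
  set K : ℝ := m₀⁻¹ * θ₀ ^ n with hK
  have hK0 : 0 ≤ K := by positivity
  have hcd : ((Torus.proj (2 * S + 1) (0 : _root_.Literature.Probability.LatticeModels.Site 4)) i₀ -
      (Torus.proj (2 * S + 1) v) i₀).valMinAbs.natAbs = n := by
    simp only [Torus.proj, Pi.zero_apply, Int.cast_zero, zero_sub]
    exact natAbs_valMinAbs_neg_intCast (v i₀) (by exact_mod_cast hvi)
  have hentry : ∀ (U : GaugeConfig 4 (2 * S + 1) SU3) (a' : Fin 3) (i : Fin 4) (b : Fin 3) (j : Fin 4),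
      ‖(diracMatrix U (M k))⁻¹ (quarkEquiv (f, (Torus.proj (2 * S + 1) 0, a', i)))
        (quarkEquiv (f, (Torus.proj (2 * S + 1) v, b, j)))‖ ≤ K := by
    intro U a' i b j
    have h := norm_inv_diracMatrix_apply_le_of_le U (M k) hm₀ hMk f (Torus.proj (2 * S + 1) 0, a', i)
      (Torus.proj (2 * S + 1) v, b, j) i₀
    rwa [hcd] at h
  have hsum : ∀ U : GaugeConfig 4 (2 * S + 1) SU3,
      (∑ a' : Fin 3, ∑ i : Fin 4, ∑ b : Fin 3, ∑ j : Fin 4,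
        ‖(diracMatrix U (M k))⁻¹ (quarkEquiv (f, (Torus.proj (2 * S + 1) 0, a', i)))
          (quarkEquiv (f, (Torus.proj (2 * S + 1) v, b, j)))‖) ≤ 144 * K := by
    intro U
    calc _ ≤ ∑ _a' : Fin 3, ∑ _i : Fin 4, ∑ _b : Fin 3, ∑ _j : Fin 4, K :=
          Finset.sum_le_sum fun a' _ => Finset.sum_le_sum fun i _ => Finset.sum_le_sum fun b _ =>
            Finset.sum_le_sum fun j _ => hentry U a' i b j
      _ = 144 * K := by simp; ring
  have hB : (144 * K) ^ (1 / 2 : ℝ) ≤ Cst * Real.exp (-(1 * (a k * ‖v‖))) := by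
    have h1 : (144 * K) = (144 * m₀⁻¹) * θ₀ ^ n := by rw [hK]; ring
    rw [h1, Real.mul_rpow (by positivity) (by positivity), hCst]
    gcongr
    have h2 : θ₀ ^ n = Real.exp ((n : ℝ) * Real.log θ₀) := by
      rw [Real.exp_nat_mul, Real.exp_log hθ₀pos]
    rw [h2, ← Real.exp_mul]
    apply Real.exp_le_exp.2
    have h3 : a k * ‖v‖ ≤ (ℓ / 2) * n :=
      mul_le_mul hak.le hnorm (norm_nonneg _) (by positivity)
    rw [hℓ] at h3
    linarith
  have hX : ∀ U : GaugeConfig 4 (2 * S + 1) SU3,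
      (∑ a' : Fin 3, ∑ i : Fin 4, ∑ b : Fin 3, ∑ j : Fin 4,
        ‖(diracMatrix U (M k))⁻¹ (quarkEquiv (f, (Torus.proj (2 * S + 1) 0, a', i)))
          (quarkEquiv (f, (Torus.proj (2 * S + 1) v, b, j)))‖) ^ (1 / 2 : ℝ) ≤
        Cst * Real.exp (-(1 * (a k * ‖v‖))) := fun U =>
    (Real.rpow_le_rpow (by positivity) (hsum U) (by norm_num)).trans hB
  set B₀ : ℝ := Cst * Real.exp (-(1 * (a k * ‖v‖))) with hB₀
  have hdet : ∀ U : GaugeConfig 4 (2 * S + 1) SU3, (diracMatrix U (M k)).det ≠ 0 := fun U =>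
    det_diracMatrix_ne_zero_of_pos U (M k) fun g => hm₀.trans_le (hMk g)
  have hZ : 0 < ∫ U : GaugeConfig 4 (2 * S + 1) SU3, ‖(diracMatrix U (M k)).det‖
      ∂(wilsonMeasure (fundamentalRep (Fin 3)) (β k)) :=
    integral_norm_det_diracMatrix_pos_of_exists (β k) (M k) ⟨fun _ => 1, hdet _⟩
  have hnum : (∫ U : GaugeConfig 4 (2 * S + 1) SU3, ‖(diracMatrix U (M k)).det‖ *
      (∑ a' : Fin 3, ∑ i : Fin 4, ∑ b : Fin 3, ∑ j : Fin 4,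
        ‖(diracMatrix U (M k))⁻¹ (quarkEquiv (f, (Torus.proj (2 * S + 1) 0, a', i)))
          (quarkEquiv (f, (Torus.proj (2 * S + 1) v, b, j)))‖) ^ (1 / 2 : ℝ)
      ∂(wilsonMeasure (fundamentalRep (Fin 3)) (β k))) ≤
      (∫ U : GaugeConfig 4 (2 * S + 1) SU3, ‖(diracMatrix U (M k)).det‖
        ∂(wilsonMeasure (fundamentalRep (Fin 3)) (β k))) * B₀ := by
    rw [← integral_mul_const]
    refine integral_mono_of_nonneg (Eventually.of_forall fun U => ?_)
      ((integrable_norm_det_diracMatrix (M k) _).mul_const B₀) (Eventually.of_forall fun U => ?_)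
    · exact mul_nonneg (norm_nonneg _) (Real.rpow_nonneg (by positivity) _)
    · exact mul_le_mul_of_nonneg_left (hX U) (norm_nonneg _)
  rw [div_le_iff₀ hZ]
  exact hnum.trans_eq (mul_comm _ _)

/-- **Flavour reduction under the phase-quenched weight**: inside any quantity multiplied by
`|det D(U)|`, the same-flavour block of the `N_f`-flavour propagator `(diracMatrix U mq)⁻¹` may be
replaced by the ONE-flavour propagator `D_W(U, m_f)⁻¹` — where every one-flavour determinant is
non-zero the two blocks agree (`inv_diracMatrix_apply_same_flavour`), and where one of them
vanishes so does the weight (`det_diracMatrix`), killing both sides.  This is the step "reduce the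
multi-flavour moment to the one-flavour Green function" of every single-flavour propagator estimate
carried out under `E_{|w|}` (no invertibility hypothesis survives). [cite: MontvayMunster1994, §5.1 (flavour-diagonal Wilson action)] -/
theorem norm_det_diracMatrix_smul_sameFlavourBlock {E : Type*} [AddCommGroup E] [Module ℝ E]
    (U : GaugeConfig 4 S SU3) (mq : Fin Nf → ℝ) (f : Fin Nf)
    (Φ : Matrix (TorusSite 4 S × Fin 3 × Fin 4) (TorusSite 4 S × Fin 3 × Fin 4) ℂ → E) :
    ‖(diracMatrix U mq).det‖ •
        Φ (Matrix.of fun p q => (diracMatrix U mq)⁻¹ (quarkEquiv (f, p)) (quarkEquiv (f, q))) =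
      ‖(diracMatrix U mq).det‖ • Φ (wilsonDirac (fundamentalRep (Fin 3)) U (mq f) 1)⁻¹ := by
  by_cases h : ∀ g, (wilsonDirac (fundamentalRep (Fin 3)) U (mq g) 1).det ≠ 0
  · congr 1
    congr 1
    ext p q
    rw [Matrix.of_apply, inv_diracMatrix_apply_same_flavour U mq h f p q]
  · push Not at h
    obtain ⟨g, hg⟩ := h
    have h0 : (diracMatrix U mq).det = 0 := by
      rw [det_diracMatrix]
      exact Finset.prod_eq_zero (Finset.mem_univ g) hg
    rw [h0, norm_zero, zero_smul, zero_smul]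

/-- Scalar form of `norm_det_diracMatrix_smul_sameFlavourBlock` for ONE entry: under the weight
`|det D(U)|`, `F(G((f,p),(f,q))) = F(D_W(U,m_f)⁻¹(p,q))` for every `F : ℂ → ℝ`. [folklore] -/
theorem norm_det_diracMatrix_mul_apply_inv_eq (U : GaugeConfig 4 S SU3) (mq : Fin Nf → ℝ) (f : Fin Nf)
    (p q : TorusSite 4 S × Fin 3 × Fin 4) (F : ℂ → ℝ) :
    ‖(diracMatrix U mq).det‖ * F ((diracMatrix U mq)⁻¹ (quarkEquiv (f, p)) (quarkEquiv (f, q))) =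
      ‖(diracMatrix U mq).det‖ * F ((wilsonDirac (fundamentalRep (Fin 3)) U (mq f) 1)⁻¹ p q) := by
  have h := norm_det_diracMatrix_smul_sameFlavourBlock (S := S) U mq f (fun M => F (M p q))
  simpa only [smul_eq_mul, Matrix.of_apply] using h

end Literature.MathematicalPhysics.QuantumFieldTheory

end
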